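import Mathlib
import HarnessLib
import Summits.ValiantsHypothesis.ValiantsHypothesis.Theses.MonotoneRestoration
import Literature.Computability.AlgebraicComplexity.ArithCircuit
import Literature.Computability.AlgebraicComplexity.ArithCircuitProofs
import Literature.Computability.AlgebraicComplexity.MonotoneStructure
import Literature.Computability.AlgebraicComplexity.PermanentIrreducible
import Literature.ModelTheory.FiniteModelTheory.CkEquiv
import Summits.ValiantsHypothesis.ValiantsHypothesis.Theorems.MonotoneRestorationMonotoneRestorationQPCosetCount
import Summits.ValiantsHypothesis.ValiantsHypothesis.Theorems.MonotoneRestorationMonotoneRestorationQPSymmetricLB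
import Summits.ValiantsHypothesis.ValiantsHypothesis.Theorems.MonotoneRestorationMonotoneRestorationQPSupportSymmetrisation
import Summits.ValiantsHypothesis.ValiantsHypothesis.Theorems.MonotoneRestorationMonotoneRestorationQPSparseRegime
import Summits.ValiantsHypothesis.ValiantsHypothesis.Theorems.MonotoneRestorationMonotoneRestorationQPBeta
import Literature.Computability.AlgebraicComplexity.SymmetricArithCircuit
import Literature.Computability.AlgebraicComplexity.DawarWilsenach2025Proofs
import Literature.GroupTheory.PermutationGroups.SmallIndexSubgroups
import Summits.ValiantsHypothesis.ValiantsHypothesis.Theorems.MonotoneRestorationQP.Negative.LoadBearing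
import Summits.ValiantsHypothesis.ValiantsHypothesis.Theorems.MonotoneRestorationMonotoneRestorationQPPermSupportCount

/-! TTRL-lite variant V19052 of stmt-ValiantsHypothesis-15886

Move `generalise` (`[concl_noX_false]`): the stub `stub_altFixing_orbit_dichotomy` with the
hypothesis `∀ x ∈ X, ρ x = x` dropped from the CONCLUSION, i.e. asking that *every* even
permutation (not only those fixing `X` pointwise) fixes `q`.  This generalisation is FALSE — the
pointwise stabiliser of `X` in the conclusion is load-bearing — and the negation is proved here by
an explicit witness at `n = 10`, `X = {0}`.
-/

-- `Summit.ValiantsHypothesis.ValiantsHypothesis.…` is the tree's mandated single-conjunct layout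
-- (Sub = Summit), so the duplicated namespace component is intended.
set_option linter.dupNamespace false

namespace Summit.ValiantsHypothesis.ValiantsHypothesis.Theorems

open Summit.ValiantsHypothesis.ValiantsHypothesis.Theses.MonotoneRestoration
open Literature.Computability.AlgebraicComplexity

/-- **TTRL-lite variant V19052 of `stub_altFixing_orbit_dichotomy` is FALSE** (move `generalise`,
the restriction `∀ x ∈ X, ρ x = x` removed from the conclusion): the conclusion of the stub cannot
leave the pointwise stabiliser of `X`.

Witness: `n = 10`, `K = ℕ`, `X = {0}`, `q = x_{00}` and `T = {x_{00}}` (so `|X| + 9 ≤ 10` and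
`|T| + |X| = 2 < 10`).  Every permutation `ρ` fixing `0` sends `x_{00}` to `x_{ρ0,ρ0} = x_{00} ∈ T`
(`MvPolynomial.rename_X`), so the orbit hypothesis holds; yet the even `3`-cycle `ρ = (0 1)(1 2)`
(which does not fix `0`) sends `x_{00}` to `x_{11} ≠ x_{00}` (`MvPolynomial.X_injective` over the
nontrivial semiring `ℕ`). -/
theorem stub_altFixing_orbit_dichotomy_var19052_false :
    ¬ (∀ (n : ℕ) (K : Type) [CommSemiring K] (q : MvPolynomial (Fin n × Fin n) K)
        (X : Finset (Fin n)), X.card + 9 ≤ n →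
        ∀ (T : Finset (MvPolynomial (Fin n × Fin n) K)), T.card + X.card < n →
        (∀ ρ : Equiv.Perm (Fin n), (∀ x ∈ X, ρ x = x) → Equiv.Perm.sign ρ = 1 →
          MvPolynomial.rename (fun p : Fin n × Fin n => (ρ p.1, ρ p.2)) q ∈ T) →
        ∀ ρ : Equiv.Perm (Fin n), Equiv.Perm.sign ρ = 1 →
          MvPolynomial.rename (fun p : Fin n × Fin n => (ρ p.1, ρ p.2)) q = q) := by
  intro h
  -- specialise to the witness
  have key := h 10 ℕ (MvPolynomial.X (0, 0)) {0} (by simp)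
    {MvPolynomial.X (0, 0)}
    (by simp)
    (by
      intro ρ hρ _
      rw [MvPolynomial.rename_X, hρ 0 (Finset.mem_singleton_self 0)]
      exact Finset.mem_singleton_self _)
    (Equiv.swap 0 1 * Equiv.swap 1 2)
    (by
      rw [Equiv.Perm.sign_mul, Equiv.Perm.sign_swap (by decide),
        Equiv.Perm.sign_swap (by decide)]
      exact Int.units_mul_self _)
  -- the even `3`-cycle moves `x_{00}` to `x_{11}`
  rw [MvPolynomial.rename_X] at key
  have h0 : ((Equiv.swap 0 1 * Equiv.swap 1 2 : Equiv.Perm (Fin 10)) 0,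
      (Equiv.swap 0 1 * Equiv.swap 1 2 : Equiv.Perm (Fin 10)) 0) = ((0 : Fin 10), (0 : Fin 10)) :=
    MvPolynomial.X_injective key
  exact absurd h0 (by decide)

end Summit.ValiantsHypothesis.ValiantsHypothesis.Theorems
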